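import Summits.PneNP.PneNP.Theorems.OracleRefusal.Negative.StaInvLamz

/-!
# `OracleRefusal` (stmt-PneNP-1864) — negative side, II: conclusion (see `StaTableDefs` for the overview)

§B.11 the word `λc.λz. chain` in the empty context (`word_runs_aux`, `word_exists_aux`, `WordLike`); §A.4 the two inversion
facts `word_exists` / `word_unique`; §A.5 the consequences: `progApply_staTable`, `staDecides_staTable`,
`sta_oracleComplete_plainObsessional`, `not_sta_oracleRefusal_plainObsessional`.
-/

namespace Summit.PneNP.PneNP.Theorems.OracleRefusal.Negative

open Literature.Computability.ImplicitComplexity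
open Literature.Computability.ImplicitComplexity.URel
open Literature.Computability.ImplicitComplexity.STA (Deriv Ctx Term LinTy SoftTy encWord encBit tyS tyB tyF mpxRen
  liftRen)

/-! ## §B.11 The word `λc.λz. chain` in the empty context -/

/-- `WordLike m T`: the head arrow of `T` (under its quantifiers) binds `m` copies of a kernel that is an
anti-instance of the step type, with a codomain whose head arrow is linear — the shape of `S_m` and of every type
above it in a derivation of a word. [cite: GaboardiMarionRonchidellarocca2008, §3.2] -/
def WordLike (m : ℕ) (T : LinTy) : Prop := ∀ k B C, peel T = .limp k B C → k = m ∧ KernelOK B ∧ ArrLike C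

/-- The kernel condition descends along a substitution. [folklore] -/
theorem KernelOK.of_substp {B : LinTy} {θ : ℕ → LinTy} (h : KernelOK (B.substp θ)) : KernelOK B := by
  obtain ⟨θ', h'⟩ := h
  exact ⟨fun i => (θ i).substp θ', by rw [← STA.LinTy.substp_substp]; exact h'⟩

/-- `WordLike` descends along a substitution. [folklore] -/
theorem WordLike.of_substp {m : ℕ} {T : LinTy} {θ : ℕ → LinTy} (h : WordLike m (T.substp θ)) : WordLike m T :=
  fun k B C hp => by
    obtain ⟨τ', h'⟩ := peel_substp_limp hp θ
    obtain ⟨hk, hK, hC⟩ := h k _ _ h'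
    exact ⟨hk, hK.of_substp, hC.of_substp⟩

/-- `S_m` is `WordLike m`. [cite: GaboardiMarionRonchidellarocca2008, §3.2] -/
theorem wordLike_tyS (m : ℕ) : WordLike m (tyS m) := by
  intro k B C h
  simp only [STA.tyS, peel_all, peel_limp, LinTy.limp.injEq] at h
  obtain ⟨rfl, rfl, rfl⟩ := h
  exact ⟨rfl, kernelOK_tyF, fun k' B' C' h' => by simp at h'; exact h'.1.symm⟩

/-- **Runs of a word code.** Every run of every derivation of `⊢ w̲ : T` (`T` WordLike `m`, empty context) has result
`Vc‾ ⅋ (Vz‾ ⅋ q)` with chain data: the iterator label `Vc` is an `m`-deep box tree over the occurrence points, each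
of which is one of its real leaves, and the tail label `Vz` is `![qs |w|]` or `![]`.
[cite: LaurentTortoraDeFalco2006, Def. 12] -/
theorem word_runs_aux : {d : ℕ} → {Γ : Ctx} → {M : Term} → {σ : SoftTy} → (D : Deriv d Γ M σ) → {w : List Bool} →
    {m : ℕ} → M = encWord w → (∀ s, Γ s = none) → σ.bangs = 0 → WordLike m σ.lin →
      ∀ {ρ : Val} {x : Point}, (ρ, x) ∈ D.interp → ∃ Vc Vz q J qs P R, x = Vc.dual.par (Vz.dual.par q) ∧ qs 0 = q ∧
        ChainData w J qs P R ∧ Vc ∈ argClique m (Lset J qs P R) ∧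
        (∀ j < J, occPt (P j) (R j) (qs j) ∈ leafSet m Vc) ∧ LamzTail Vz w.length J qs R
  | _, _, _, _, .ax _, _, _, hM, _, _, _, _, _, _ => by cases hM
  | _, _, _, _, .weak j A h hj hΓ', _, _, _, hn, _, _, _, _, _ => by
      have := hn j; rw [hΓ'] at this; simp at this
  | _, _, _, _, .lam (k := k) (B := B) (A := A) (Γ := Γ) h, w, m, hM, hn, _, hW, ρ, x, hr => by
      obtain ⟨rfl, hKB, hA⟩ := hW k B A rfl
      have hN : _ = Term.lam (STA.chainTo 1 w) := Term.lam.inj (hM.trans (STA.encWord_eq_chainTo w))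
      have hC : IsChain 0 (STA.chainTo 1 w) w ((List.replicate w.length 0).map (· + 1)) := by
        rw [List.map_replicate]; exact isChain_chainTo 1 w
      have hK : ∀ c ∈ List.replicate w.length 0, ∃ k' K, Ctx.cons (some ⟨k, B⟩) Γ c = some ⟨k', K⟩ ∧ KernelOK K :=
        fun c hc => by rw [List.eq_of_mem_replicate hc]; exact ⟨k, B, rfl, hKB⟩
      obtain ⟨ρ₁, p, Vc, hm, h0, he⟩ := hr
      simp only [Prod.mk.injEq] at he
      obtain ⟨rfl, rfl⟩ := he
      obtain ⟨Vz, q, J, qs, P, R, rfl, hq, hD, hH, hT⟩ := lamz_runs h hN hC rfl hA hK hm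
      obtain ⟨hHd, hNn, hCov⟩ := hH
      have hVc : Vc ∈ argClique k (Lset J qs P R) := by
        by_cases h0m : (0 : ℕ) ∈ List.replicate w.length 0
        · obtain ⟨V, hV, hVm⟩ := hHd 0 h0m ⟨k, B⟩ rfl
          rw [h0] at hV; cases hV; exact hVm
        · obtain ⟨V, hV, hVm⟩ := hNn 0 h0m (Set.notMem_empty _) ⟨k, B⟩ rfl
          rw [h0] at hV; cases hV; exact junk_subset_argClique _ _ hVm
      refine ⟨Vc, Vz, q, J, qs, P, R, rfl, hq, hD, hVc, fun j hj => ?_, hT⟩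
      obtain ⟨s, hs, σ, V, hΓs, hρs, hmm⟩ := hCov j hj
      rw [List.eq_of_mem_replicate hs] at hΓs hρs
      cases hΓs
      rw [h0] at hρs; cases hρs
      exact hmm
  | _, _, _, _, .app _ _ _, _, _, hM, _, _, _, _, _, _ => by cases hM
  | _, _, _, _, .mpx S j h hS hj hΓ' hM', _, _, _, hn, _, _, _, _, _ => by
      have hjS : j ∉ S := fun hj' => by simpa [hj] using hS j hj'
      have := hn j; rw [hΓ'] at this; simp [Ctx.mpx, hjS] at this
  | _, _, _, _, .sp _ _, _, _, _, _, hσ, _, _, _, _ => by simp at hσ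
  | _, _, _, _, .allI (Γ := Γ) h hΔ, w, m, hM, hn, _, hW, ρ, x, hr =>
      word_runs_aux h hM (fun s => by rw [hΔ]; simp [Ctx.shift, hn s]) rfl (fun k B C hp => hW k B C hp) hr
  | _, _, _, _, .allE _ h, _, _, hM, hn, _, hW, _, _, hr =>
      word_runs_aux h hM hn rfl (fun k B C hp => hW.of_substp k B C hp) hr
  | _, _, _, _, .sum _ _, _, _, hM, _, _, _, _, _, _ => by cases hM

/-- **Existence of the canonical run of a word code**: for every choice of chain values `qs`, every derivation of
`⊢ w̲ : T` (`T` WordLike `m`, empty context) has a run with result `Vc‾ ⅋ (![qs |w|]‾ ⅋ qs 0)` whose iterator label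
is an `m`-deep box tree over the canonical occurrence points. [cite: LaurentTortoraDeFalco2006, Def. 12] -/
theorem word_exists_aux : {d : ℕ} → {Γ : Ctx} → {M : Term} → {σ : SoftTy} → (D : Deriv d Γ M σ) → {w : List Bool} →
    {m : ℕ} → M = encWord w → (∀ s, Γ s = none) → σ.bangs = 0 → WordLike m σ.lin →
      ∀ as qs : ℕ → Point, ∃ (ρ : Val) (Vc : Point),
        (ρ, Vc.dual.par ((bang1 (qs w.length)).dual.par (qs 0))) ∈ D.interp ∧
          Vc ∈ argClique m (Lset w.length qs (canonP w as) (canonR qs))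
  | _, _, _, _, .ax _, _, _, hM, _, _, _, _, _ => by cases hM
  | _, _, _, _, .weak j A h hj hΓ', _, _, _, hn, _, _, _, _ => by
      have := hn j; rw [hΓ'] at this; simp at this
  | _, _, _, _, .lam (k := k) (B := B) (A := A) (Γ := Γ) h, w, m, hM, hn, _, hW, as, qs => by
      obtain ⟨rfl, hKB, hA⟩ := hW k B A rfl
      have hN : _ = Term.lam (STA.chainTo 1 w) := Term.lam.inj (hM.trans (STA.encWord_eq_chainTo w))
      have hC : IsChain 0 (STA.chainTo 1 w) w ((List.replicate w.length 0).map (· + 1)) := by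
        rw [List.map_replicate]; exact isChain_chainTo 1 w
      have hK : ∀ c ∈ List.replicate w.length 0, ∃ k' K, Ctx.cons (some ⟨k, B⟩) Γ c = some ⟨k', K⟩ ∧ KernelOK K :=
        fun c hc => by rw [List.eq_of_mem_replicate hc]; exact ⟨k, B, rfl, hKB⟩
      obtain ⟨ρ₁, hm, hH⟩ := lamz_exists h hN hC rfl hA hK as qs
      obtain ⟨hHd, hNn, -⟩ := hH
      have hVc : ∃ Vc, ρ₁ 0 = some Vc ∧ Vc ∈ argClique k (Lset w.length qs (canonP w as) (canonR qs)) := by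
        by_cases h0m : (0 : ℕ) ∈ List.replicate w.length 0
        · exact hHd 0 h0m ⟨k, B⟩ rfl
        · obtain ⟨V, hV, hVm⟩ := hNn 0 h0m (Set.notMem_empty _) ⟨k, B⟩ rfl
          exact ⟨V, hV, junk_subset_argClique _ _ hVm⟩
      obtain ⟨Vc, h0, hVm⟩ := hVc
      exact ⟨_, Vc, ⟨ρ₁, _, Vc, hm, h0, rfl⟩, hVm⟩
  | _, _, _, _, .app _ _ _, _, _, hM, _, _, _, _, _ => by cases hM
  | _, _, _, _, .mpx S j h hS hj hΓ' hM', _, _, _, hn, _, _, _, _ => by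
      have hjS : j ∉ S := fun hj' => by simpa [hj] using hS j hj'
      have := hn j; rw [hΓ'] at this; simp [Ctx.mpx, hjS] at this
  | _, _, _, _, .sp _ _, _, _, _, _, hσ, _, _, _ => by simp at hσ
  | _, _, _, _, .allI (Γ := Γ) h hΔ, w, m, hM, hn, _, hW, as, qs =>
      word_exists_aux h hM (fun s => by rw [hΔ]; simp [Ctx.shift, hn s]) rfl (fun k B C hp => hW k B C hp) as qs
  | _, _, _, _, .allE _ h, _, _, hM, hn, _, hW, as, qs =>
      word_exists_aux h hM hn rfl (fun k B C hp => hW.of_substp k B C hp) as qs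
  | _, _, _, _, .sum _ _, _, _, hM, _, _, _, _, _ => by cases hM


/-! ## §A.4 The two inversion facts about arbitrary derivations of word codes -/

/-- Occurrence points are determined by their three labels. [folklore] -/
theorem occPt_inj {P R q P' R' q' : Point} (h : occPt P R q = occPt P' R' q') : P = P' ∧ R = R' ∧ q = q' := by
  obtain ⟨h1, h2⟩ := row_eq h
  obtain ⟨h3, h4⟩ := row_eq h2
  exact ⟨h1, h3, h4⟩

/-- The occurrence points of `w` are the canonical occurrence points at the labels `lab`. [folklore] -/
theorem occ_eq_occPt (w : List Bool) (j : ℕ) :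
    occ w j = occPt (canonP w (fun _ => Point.one) j) (canonR (fun i => lab i) j) (lab j) := rfl

/-- **Existence of the canonical point.** Every typing derivation of a word code `⊢ w̲ : S_m` — whatever its
administrative rules, dummies and multiplexor trees — has a run producing a canonical point of `w`.
[cite: LaurentTortoraDeFalco2006, Def. 12] -/
theorem word_exists (w : List Bool) {m d : ℕ} (D : Deriv d Ctx.empty (encWord w) ⟨0, tyS m⟩) :
    ∃ x ∈ staX m w, x ∈ SoftProgramInterpretation D := by
  obtain ⟨ρ, Vc, hm, hVc⟩ := word_exists_aux D rfl (fun _ => rfl) rfl (wordLike_tyS m) (fun _ => Point.one) fun j => lab j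
  have hL : Lset w.length (fun j => lab j) (canonP w fun _ => Point.one) (canonR fun j => lab j) = occSet w := by
    ext a; simp only [Lset, occSet, Set.mem_setOf_eq, occ_eq_occPt]
  exact ⟨staRow w Vc, ⟨Vc, hL ▸ hVc, rfl⟩, ρ, hm⟩

/-- **Canonical points are unambiguous.** A canonical point of `w` is a result of a derivation of `⊢ w'̲ : S_m`
only if `w' = w`: follow the chain of state labels from `lab 0`, reading off one letter of `w'` and of `w` at each
step, until the tail label `![lab |w|]`. [cite: LaurentTortoraDeFalco2006, Def. 12] -/
theorem word_unique {w w' : List Bool} {m d : ℕ} (D : Deriv d Ctx.empty (encWord w') ⟨0, tyS m⟩)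
    {x : Point} (hx : x ∈ staX m w) (hD : x ∈ SoftProgramInterpretation D) : w' = w := by
  obtain ⟨V, hV, rfl⟩ := hx
  obtain ⟨ρ, hr⟩ := hD
  obtain ⟨Vc, Vz, q, J, qs, P, R, he, hq, hDt, -, hCov, hT⟩ :=
    word_runs_aux D rfl (fun _ => rfl) rfl (wordLike_tyS m) hr
  obtain ⟨rfl, he2⟩ := row_eq he
  obtain ⟨hVz, rfl⟩ := row_eq he2
  obtain ⟨-, -, hP, hR⟩ := hDt
  -- the tail: everything evaluated, tail used at `lab |w|`
  have hT' : J = w'.length ∧ (∀ j, j + 1 = w'.length → R j = bang1 (qs w'.length)) ∧ qs w'.length = lab w.length := by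
    rcases hT with ⟨h1, h2, h3⟩ | ⟨-, -, h3⟩
    · exact ⟨h1, h2, bang1_injective (h3.symm.trans hVz.symm)⟩
    · exact absurd (hVz.trans h3) (bang1_ne_bang0 _)
  obtain ⟨rfl, hRn, hqn⟩ := hT'
  have hRall : ∀ j, j + 1 ≤ w'.length → R j = bang1 (qs (j + 1)) := fun j hj => by
    rcases Nat.lt_or_ge (j + 1) w'.length with h | h
    · exact hR j h
    · have hj' : j + 1 = w'.length := by omega
      rw [hRn j hj', hj']
  -- follow the chain
  have key : ∀ j, j ≤ w'.length → qs j = lab j ∧ ∀ i < j, i < w.length ∧ w'.getD i false = w.getD i false := by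
    intro j
    induction j with
    | zero => exact fun _ => ⟨hq, fun i hi => by omega⟩
    | succ j ih =>
      intro hj
      obtain ⟨hqj, hprev⟩ := ih (by omega)
      obtain ⟨i, hi, hei⟩ := leafSet_subset_of_mem_argClique hV (hCov j (by omega))
      rw [occ_eq_occPt] at hei
      obtain ⟨hP', hR', hq'⟩ := occPt_inj hei
      obtain rfl : i = j := lab_injective (hq'.symm.trans hqj)
      refine ⟨bang1_injective ((hRall i hj).symm.trans hR'), fun i' hi' => ?_⟩
      rcases Nat.lt_or_ge i' i with h | h
      · exact hprev i' h
      · obtain rfl : i' = i := by omega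
        refine ⟨hi, ?_⟩
        rcases hP i' (by omega) with h0 | ⟨β, hβ, hβe⟩
        · exact absurd (hP'.symm.trans h0) (bang1_ne_bang0 _)
        · have hβ' : β = bitPtAt (w.getD i' false) Point.one := bang1_injective (hβe.symm.trans hP')
          subst hβ'
          exact eq_of_mem_bitClique hβ (bitPt_mem _)
  obtain ⟨hqn', hall⟩ := key w'.length le_rfl
  have hlen : w'.length = w.length := lab_injective (hqn'.symm.trans hqn)
  apply List.ext_getElem hlen
  intro i h1 h2
  have := (hall i h1).2
  rwa [List.getD_eq_getElem _ _ h1, List.getD_eq_getElem _ _ h2] at this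

/-! ## §A.5 Consequences for the crux at the STA-native interface -/

/-- Semantic application of the table to ANY derivation of `w̲` answers exactly `ansClique (χ_O w)`.
[cite: LaurentTortoraDeFalco2006, Def. 12] -/
theorem progApply_staTable (n : ℕ) {m d : ℕ} (O : Language Bool) (w : List Bool)
    (D : Deriv d Ctx.empty (encWord w) ⟨0, tyS m⟩) :
    progApply n (staTable n m O) (SoftProgramInterpretation D) = ansClique (chi O w) := by
  ext b
  rw [mem_progApply]
  constructor
  · rintro ⟨V, hV, w', x, out, hx, hout, he⟩
    obtain ⟨rfl, rfl⟩ := row_eq he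
    have hxD : x ∈ SoftProgramInterpretation D := nest_mem_argClique_iff.1 hV
    rwa [word_unique D hx hxD]
  · intro hb
    obtain ⟨x, hx, hxD⟩ := word_exists w D
    exact ⟨nest n x, nest_mem_argClique_iff.2 hxD, w, x, b, hx, hb, rfl⟩

/-- **The STA table decides `O`** at the interface `!ⁿ S_m ⊸ B`, for every `n` and `m`. [folklore] -/
theorem staDecides_staTable (n m : ℕ) (O : Language Bool) : STADecides n m (staTable n m O) O := by
  intro w d D
  refine ⟨fun hw => ?_, fun hw => ?_⟩
  · have hc : chi O w = true := by simpa [chi] using hw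
    rw [progApply_staTable, hc]; rfl
  · have hc : chi O w = false := by simpa [chi] using hw
    rw [progApply_staTable, hc]; rfl

/-- **Plain obsessionality is oracle-complete at the STA-native interface**: EVERY language — recursive or not — is
decided in the sense of `URel.STADecides n m`, for every `n, m`, by a clique obsessional from `1` (the threshold of
every interpretation of an affine soft derivation, `obsessionalFrom_softProgramInterpretation`). [folklore] -/
theorem sta_oracleComplete_plainObsessional (O : Language Bool) (n m : ℕ) :
    ∃ c : Set Point, ObsessionalFrom 1 c ∧ STADecides n m c O :=
  ⟨staTable n m O, obsessionalFrom_staTable n m O, staDecides_staTable n m O⟩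

/-- **The STA-native typable form of `OracleRefusal` is false**: with `Φ⁰_t :=` "obsessional from `t`" no language is
refused at the interface `URel.STADecides`, at any level `t ≥ 1`, number of promotions `n` and string type `S_m`.
[folklore] -/
theorem not_sta_oracleRefusal_plainObsessional :
    ¬ ∃ O : Language Bool, ∀ (t n m : ℕ) (c : Set Point), 1 ≤ m → ObsessionalFrom t c → ¬ STADecides n m c O := by
  rintro ⟨O, hO⟩
  obtain ⟨c, hc, hd⟩ := sta_oracleComplete_plainObsessional O 1 1
  exact hO 1 1 1 c le_rfl hc hd

end Summit.PneNP.PneNP.Theorems.OracleRefusal.Negative
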